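import Summits.HodgeConjecture.CorCM.HypLiu418.A3Liu418EpsRigidFaceTypes
import Summits.HodgeConjecture.CorCM.HypLiu418.A3Liu418FaceTypes
import Summits.HodgeConjecture.CorCM.HypLiu418.A3Liu418NonIso
import Summits.HodgeConjecture.CorCM.HypD3.A4LiuD3StubsByName
import Summits.HodgeConjecture.CorCM.D2Bridge.ConjugateRestTransport
import Summits.HodgeConjecture.HodgeConjecture.Theorems.HCCMUnconditionalHD1pp
import Literature.NumberTheory.Automorphic.Liu2021.Def411WeilCarriersLocalTypesOfSemilinearEquiv
import Literature.NumberTheory.Automorphic.Liu2021.Def411ChiGaloisTwist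
import Literature.NumberTheory.Automorphic.Liu2021.LemD1Item3AtVOfSeparation
import Literature.NumberTheory.Automorphic.Liu2021.LemD1AsPrintedIndexedNonVacuitySlots
import Literature.NumberTheory.Automorphic.AdelicAdditiveCharacterGaloisTwist
import Literature.RepresentationTheory.Semisimple.SemilinearIsomorphicRep
import Literature.RepresentationTheory.MoeglinVignerasWaldspurger1987.RankOneThetaLiftLinesDisjointHolds
import HarnessLib

/-!
# Line `a3-liu418`, row III-11: `EpsRigidAtFace` (ε-rigidity under Galois twist at `V`'s own relabelled rest) FROM the road's three local facts

Summits side, binder subdirectory `CorCM/HypLiu418/` (cell `hodgecm-mathlib`, fan A, rung A-III; crux item stmt-HodgeConjecture-24832, registered residual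
`stub_epsRigidAtFace : EpsRigidAtFace` of `Cruxes/HLiu418/Lines/a3_liu418.lean` v8 :356 = row III-11 `Thm418Data.EpsRigidUnderGaloisTwist` at the face datum
`D₀ = toThm418Data ℭ_V ((muConj 𝕌_V).rest t_ν)`).  THEOREMS ONLY, no `sorry`.  The CLOSING THEOREM of the road memo `A-provers/A-p19/ROAD-III11-v2.md`
(af743dc36c4b04cf; director g2 BATCH 28/36 «memo of record»):

  `epsRigidAtFace_of_localTwist (hT : LocalTypeGaloisTwist) (hN : CyclotomicUnitIsLocalNormOdd) (hN₂ : CyclotomicUnitIsLocalNormDyadic)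
     (hS : PrescribedLocalSquareClass) : EpsRigidAtFace`

whose three (four) binders are the TYPES of ✔ `A3Liu418EpsRigidFaceTypes.lean` (p611602), closed by name by the fan-B ∕ (NT) hands (B-p03 over
B-p08/B-p13/B-p14; A-p11; A-p12).  THE PROOF ([Liu2021, Thm. 4.18 (3)] proof l. 2272–2289, read through the doubling normalisation — see the FaceTypes module
docstring): for `σ ∈ Aut(ℂ/M_ν)`, two `ν`-admissible indices `i, j` and a `σ`-semilinear `𝔾(𝔸_F^∞)`-isomorphism `ω_i → ω_j`:
* (face ↦ own family) `D₀`'s summands are `V`'s OWN [Def 4.11] carriers at the label `μ₀ := νᶜ` (`muConj`, `rfl`), `M_{νᶜ} = M_ν`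
  (✔ `fieldOfValues_galConj_complexConj`); so work at `V`'s own rest `𝔯δ′⟦r_a, μ₀⟧ = restOfCharDeltaPrime …` (`epsRigid_muConj_rest`).
* (P2, ✔ p610317) the isomorphism restricts at every finite `v` to a `σ`-semilinear `U(J_V)(F⁺_v)`-equivariant bijection of LOCAL TYPES
  `X_v(a_i, χ_i) → X_v(a_j, χ_j)` (irreducible by [Lem D.1 (1)] = ✔ `HD1pp_proof`, item 24838 CLOSED; `ω_i ≠ 0`).
* at a NON-SPLIT `v`: `κ_σ` with `σ ∘ ψ_v = ψ_v(κ_σ ·)` (✔ B-p13 `exists_ringEquiv_adeleAddCharAt_eq_mul`), a global `t` with `s² t = κ_σ` (`hS`), the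
  member `(t·a_i, σ∘χ_i)` (✔ `isAutomorphicOneChar_unitsMap_ringEquiv_comp_chi`), and `hT`: `X_v(a_i,χ_i)^σ ≅ X_v(t a_i, σ∘χ_i)`; TWO-OUT-OF-THREE
  (✔ `AreSemilinearIso.exists_linearEquiv_of_two`) gives a LINEAR `X_v(t a_i, σ∘χ_i) ≅ X_v(a_j, χ_j)`, and [Lem D.1 (3)]'s `ε`-CLAUSE on the 3-member
  family (✔ `sameClassChiOfIsoNonsplit_holds` + ✔ `rankOne_theta_lines_disjoint_holds` — item (3) needs ONLY row IV-4c1, not c3) gives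
  `t a_i ≡ a_j mod Nm`; `hN`/`hN₂`: `κ_σ ∈ Nm` ⇒ `a_i ≡ a_j mod Nm` at `v`.
* at a SPLIT `v`: one class (✔ `sameClassOfSplit_holds`).
* all `v` ⇒ `locF a_i = locF a_j` (✔ `locF_eq_of_forall_sameClass_epsLine`) ⇒ `ε_i = ε_j` (admissible collections are global, faithful section `r_a`).
HC_CM is proved only modulo the 7 printed citations (`hDel`, `h21`, `hLiu418`, `h411`, `h413`, `hD3`, `hD1''`) until rung 0 closes; this file
discharges none of them by itself (row III-11 closes when the three binders land).

## References
* [Liu2021] Y. Liu, Camb. J. Math. 9 (2021) = arXiv:2102.11518 — Thm. 4.18 (3) (l. 2243) with proof l. 2272–2289; Def. 4.11–4.12; App. D Lem. D.1 (1), (3).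
* [FlathCorvallis1979] Theorem 3 (uniqueness clause).  [MoeglinVignerasWaldspurger1987] Chap. 2 II.1, Chap. 3 IV.4.

**Edition 2 (A-p19 g9, 2026-08-29; cone-edition lane, A-p01 budget audit rank #3 / A-p18 census ED-ER-HB):** every declaration statement and
docstring byte-identical to ★ p614667.  `epsRigidAtFace_of_localTwist`: the face goal left by `epsRigid_muConj_rest` is rewritten ONCE along
✔ `restOfCharRep_eq_rest` (`rfl`, used as a rewrite exactly as in `A3Liu418MainGaloisGlue` §1) so that §2's `restOfCharDeltaPrime`-spelled
`epsRigid_ownRest_of_localTwist` is applied near-syntactically — measured 1.82 M → < 0.8 M heartbeats (budget 8 M → 800 k); `epsRigid_ownRest_of_localTwist`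
(1.70 M measured, a long per-place case analysis) keeps its 4 M budget (≈ 2.3× headroom).
-/

set_option autoImplicit false

noncomputable section

namespace Summit.HodgeConjecture.CorCM.Lines.A3Liu418

open scoped TensorProduct Matrix
open NumberField NumberField.InfinitePlace IsDedekindDomain
open HodgeCM.Model HodgeCM.Model.LiuIndex HodgeCM.Model.TowerCarrier
open Summit.HodgeConjecture.CorCM.Model
open Literature.AlgebraicGeometry.Motives (CMType)
open Literature.AlgebraicGeometry.HodgeTheory Literature.NumberTheory.Automorphic.PicardCM
open Literature.AlgebraicGeometry.ShimuraVarieties.UnitaryCanonicalModel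
open Literature.NumberTheory.ComplexMultiplication
open Literature.NumberTheory.Automorphic
open Literature.NumberTheory.Automorphic.IdeleClassGroup (toHeckeCharacter isUnitary_toHeckeCharacter galConj)
open Literature.NumberTheory.Automorphic.Liu2021 Literature.NumberTheory.Automorphic.Liu2021.AppendixC
open Literature.NumberTheory.Automorphic.Liu2021.AppendixC.RestOne
open Literature.NumberTheory.Automorphic.Liu2021.Def411WeilCarriers (lineOf locF Rep Eps epsOf Chi epsLine)
open Summit.HodgeConjecture.CorCM.Transposition.OmegaTransport (realUnit)
open HodgeCM.Model.ArchSideTerm (e₁)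
open Literature.NumberTheory.GelbartRogawski1991 Literature.NumberTheory.GelbartRogawski1991.UnitaryDualPair
open Literature.NumberTheory.GelbartRogawski1991.UnitaryDualPair.LocalSplitting (localMu norm_localMu continuous_localMu localMu_toLocalRing_eq_one_iff)
open Literature.RepresentationTheory Literature.RepresentationTheory.Liu2021
open Summit.HodgeConjecture.CorCM.Transposition
open Summit.HodgeConjecture.CorCM.D2Bridge.AdapterMuConj (muConj admIndexMuConjEquiv)
open Summit.HodgeConjecture.CorCM.Lines.A4LiuD3 (famAtV sameClassChiOfIsoNonsplit_holds sameClassOfSplit_holds)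
open Literature.RepresentationTheory.MoeglinVignerasWaldspurger1987 (rankOne_theta_lines_disjoint_holds)

/-! ## §0 Plumbing: every finite place has a residue characteristic; re-typing a semilinear map along equal ring homomorphisms -/

/-- Every height-one prime `v` of `𝓞 K` contains a rational prime `p` (its residue characteristic): `N(v) ∈ v` is a product of primes and `v` is prime.
[folklore] -/
private theorem exists_prime_natCast_mem {K : Type} [Field K] [NumberField K] (v : HeightOneSpectrum (𝓞 K)) :
    ∃ p : ℕ, p.Prime ∧ ((p : ℕ) : 𝓞 K) ∈ v.asIdeal := by
  classical
  haveI := v.isPrime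
  have hn0 : Ideal.absNorm v.asIdeal ≠ 0 := fun h => v.ne_bot (Ideal.absNorm_eq_zero_iff.mp h)
  have hmem : ((Ideal.absNorm v.asIdeal : ℕ) : 𝓞 K) ∈ v.asIdeal := Ideal.absNorm_mem _
  rw [Nat.prod_primeFactors_pow_factorization hn0, Nat.cast_prod] at hmem
  obtain ⟨q, hq, hqv⟩ := Ideal.IsPrime.prod_mem_iff.1 hmem
  rw [Nat.cast_pow] at hqv
  exact ⟨q, Nat.prime_of_mem_primeFactors hq, v.isPrime.mem_of_pow_mem _ hqv⟩

/-- Re-typing a bijective equivariant semilinear map along an equality of ring homomorphisms `τ₁ = τ₂` (same underlying function). [folklore] -/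
private theorem exists_semilinear_of_ringHom_eq {k k' : Type*} [Field k] [Field k'] {τ₁ τ₂ : k →+* k'} (hτ : τ₁ = τ₂)
    {G : Type*} {V V' : Type*} [AddCommGroup V] [Module k V] [AddCommGroup V'] [Module k' V'] (ρ : G → V → V) (ρ' : G → V' → V')
    (h : ∃ f : V →ₛₗ[τ₁] V', Function.Bijective f ∧ ∀ (g : G) (x : V), f (ρ g x) = ρ' g (f x)) :
    ∃ f : V →ₛₗ[τ₂] V', Function.Bijective f ∧ ∀ (g : G) (x : V), f (ρ g x) = ρ' g (f x) := by
  subst hτ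
  exact h

/-! ## §1 ε-rigidity transfers along `μ ↦ μᶜ` (`AdapterMuConj.muConj`): the summands are equal on the nose, `M_{νᶜ} = M_ν` is supplied by the caller -/

section MuConj

variable {F₀ E₀ : Type} {iF₁ : Field F₀} {iF₂ : NumberField F₀} {iF₃ : IsTotallyReal F₀} {iE₁ : Field E₀} {iE₂ : NumberField E₀}
  {iA : Algebra F₀ E₀} {iE₃ : IsTotallyComplex E₀} {iQ : Algebra.IsQuadraticExtension F₀ E₀}
variable {P5 : PropC5Data F₀ E₀} {isotropicAt : ℕ → Prop} {C : Sec42Data P5 isotropicAt}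

/-- **ε-rigidity under Galois twist transfers along `μ = νᶜ`**: the summands of [Thm. 4.18] at the `ν`-rest of `muConj U` ARE those at the `μ`-rest of `U`
(✔ `muConj_omega`, `rfl`) along ✔ `admIndexMuConjEquiv` (identity on `(ε, χ)`); so ε-rigidity for ALL `σ : ℂ ≃+* ℂ` fixing `M_ν` at the `μ`-rest of `U`
gives `Thm418Data.EpsRigidUnderGaloisTwist` at the `ν`-rest of `muConj U` (whose `μ`-field is `ν`). [cite: Liu2021, Thm. 4.18 (3) (l. 2243), Rem. 4.4, Def. 4.12 (l. 2108–2111)] -/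
theorem epsRigid_muConj_rest (U : UniformOmega C) {μ ν : Literature.NumberTheory.Automorphic.IdeleClassGroup E₀ →ₜ* Circle}
    {hμ : letI : IsCMField E₀ := isCMField F₀ E₀; IdeleClassGroup.IsConjugateSymplectic E₀ μ}
    {hν : letI : IsCMField E₀ := isCMField F₀ E₀; IdeleClassGroup.IsConjugateSymplectic E₀ ν}
    (t : RestTail C μ hμ) (tc : RestTail C ν hν)
    (h : letI : IsCMField E₀ := isCMField F₀ E₀; μ = galConj (IsCMField.complexConj E₀) ν)
    (hE : ∀ (σ : ℂ ≃+* ℂ), (∀ z : ℂ, z ∈ fieldOfValues E₀ ν → σ z = z) →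
      ∀ i j : (toThm418Data C (U.rest t)).AdmIndex,
        (∃ f : (toThm418Data C (U.rest t)).omegaAt i →ₛₗ[(σ : ℂ →+* ℂ)] (toThm418Data C (U.rest t)).omegaAt j,
            Function.Bijective f ∧ ∀ (g : (toThm418Data C (U.rest t)).G) (w : (toThm418Data C (U.rest t)).omegaAt i),
              f ((toThm418Data C (U.rest t)).rhoAt i g w) = (toThm418Data C (U.rest t)).rhoAt j g (f w)) →
        i.1.1 = j.1.1) :
    (toThm418Data C ((muConj U).rest tc)).EpsRigidUnderGaloisTwist := by
  subst h
  intro σ i' j' hij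
  obtain ⟨f, hf, hfe⟩ := hij
  have hσ : ∀ z : ℂ, z ∈ fieldOfValues E₀ ν → (σ : ℂ ≃+* ℂ) z = z := fun z hz => σ.commutes ⟨z, hz⟩
  have hστ : ((σ : ℂ ≃+* ℂ) : ℂ →+* ℂ) = (σ : ℂ →+* ℂ) := RingHom.ext fun _ => rfl
  have key := hE (σ : ℂ ≃+* ℂ) hσ ((admIndexMuConjEquiv U t tc rfl).symm i') ((admIndexMuConjEquiv U t tc rfl).symm j')
    (exists_semilinear_of_ringHom_eq hστ.symm _ _ ⟨f, hf, hfe⟩)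
  exact key

end MuConj

/-! ## §2 A units identity and ε-rigidity at `V`'s OWN rest `𝔯δ′⟦r, μ⟧` from the road's three local facts -/

section OwnRest

/-- Units bookkeeping in the commutative group `E_vˣ` (`C` = conjugation): from `ε_t = m ε_i`, `ε_t = x x̄ ε_j`, `y ȳ = S S m` and `S̄ = S`
conclude `ε_j = z z̄ ε_i` for `z = x⁻¹ S⁻¹ y`. [folklore] -/
private theorem units_sameClass_chain {G : Type*} [CommGroup G] (C : G →* G) {εi εj εt m x y S : G} (h1 : εt = m * εi)
    (h2 : εt = x * C x * εj) (h3 : y * C y = S * S * m) (hS : C S = S) :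
    εj = (x⁻¹ * S⁻¹ * y) * C (x⁻¹ * S⁻¹ * y) * εi := by
  have hm : m = (S * S)⁻¹ * (y * C y) := eq_inv_mul_of_mul_eq h3.symm
  have hj : εj = (x * C x)⁻¹ * (m * εi) := eq_inv_mul_of_mul_eq (h2.symm.trans h1)
  rw [hj, hm, map_mul, map_mul, map_inv, map_inv, hS, mul_inv_rev, mul_inv_rev]
  apply Additive.ofMul.injective
  simp only [ofMul_mul, ofMul_inv]
  abel


/-- `AreSemilinearIso` composed with two `Representation.Equiv`s (types pinned by the equivalences). [folklore] -/
private theorem areSemilinearIso_of_equivs {k k' : Type*} [Field k] [Field k'] {τ : k →+* k'} {G : Type*} [Monoid G]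
    {V₀ V V' V₀' : Type*} [AddCommGroup V₀] [Module k V₀] [AddCommGroup V] [Module k V] [AddCommGroup V'] [Module k' V']
    [AddCommGroup V₀'] [Module k' V₀'] {ρ₀ : Representation k G V₀} {ρ : Representation k G V} {ρ' : Representation k' G V'}
    {ρ₀' : Representation k' G V₀'} (E : ρ₀.Equiv ρ) (E' : ρ₀'.Equiv ρ')
    (h : Literature.RepresentationTheory.Semisimple.AreSemilinearIso τ ρ ρ') :
    Literature.RepresentationTheory.Semisimple.AreSemilinearIso τ ρ₀ ρ₀' := by
  refine (h.linearEquiv_trans E.toLinearEquiv fun g v => ?_).trans_linearEquiv E'.symm.toLinearEquiv fun g v => ?_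
  · rw [Representation.Equiv.toLinearEquiv_apply, Representation.Equiv.toLinearEquiv_apply]
    exact E.toIntertwiningMap.isIntertwining _ _ g v
  · rw [Representation.Equiv.toLinearEquiv_apply, Representation.Equiv.toLinearEquiv_apply]
    exact E'.symm.toIntertwiningMap.isIntertwining _ _ g v

set_option maxHeartbeats 4000000 in
set_option synthInstance.maxHeartbeats 400000 in
/-- **ε-RIGIDITY UNDER GALOIS TWIST at `V`'s own one-label rest** `𝔯δ′⟦r, μ⟧ = restOfCharDeltaPrime … r μ hμ hw` (= `toThm418Data ℭ_V (𝕌_V.rest t_μ)`, face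
bijection `e₁`, any real frame `dV`, `ιV` onto, any faithful section `r`): for `σ : ℂ ≃+* ℂ` fixing `M_μ` and admissible indices `i, j`, a `σ`-semilinear
`𝔾(𝔸_F^∞)`-equivariant bijection `ω_i → ω_j` forces `ε_i = ε_j` — FROM the binders `LocalTypeGaloisTwist`, `CyclotomicUnitIsLocalNorm{Odd,Dyadic}`,
`PrescribedLocalSquareClass`, the pair-form [Lem D.1 (1)] row `hD1R`, and the tree (σ-restriction ✔ p610317, cyclotomic unit ✔ B-p13, `σ∘χ` automorphic ✔,
[Lem D.1 (3)] `ε`-clause per place ✔ + c1 ✔, globalisation ✔, faithful section).  The per-place heart: at non-split `v`, the 3-member family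
`(a_i, χ_i), (t a_i, σ∘χ_i), (a_j, χ_j)`; `X_v(a_i,χ_i)^σ ≅ X_v(t a_i, σ∘χ_i)` (hT) and `X_v(a_i,χ_i)^σ ≅ X_v(a_j,χ_j)` (restriction) give a LINEAR
`X_v(t a_i, σ∘χ_i) ≅ X_v(a_j,χ_j)` (two-out-of-three), so `t a_i ≡ a_j`, and `t ≡ κ_σ ≡ 1 mod Nm`.
[cite: Liu2021, Thm. 4.18 (3) with proof l. 2272–2289; Def. 4.11–4.12; App. D Lem. D.1 (1), (3)] [cite: FlathCorvallis1979, Theorem 3 (uniqueness clause)] -/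
theorem epsRigid_ownRest_of_localTwist (hT : LocalTypeGaloisTwist) (hN : CyclotomicUnitIsLocalNormOdd)
    (hN₂ : CyclotomicUnitIsLocalNormDyadic) (hS : PrescribedLocalSquareClass)
    (h : exists_recordSystem) (F : HodgeCM.CMField) [IsGalois ℚ F] (h6 : 6 ≤ Module.finrank ℚ F) (ι₁ : (F : Type) →+* ℂ)
    (V : Summit.HodgeConjecture.CorCM.HermSpace3 ⟨HodgeCM.CMField.K F⟩ ι₁) (Φ : CMType F) (dV : Fin 3 → (F : Type))
    (hdV : ∀ k, IsCMField.complexConj (F : Type) (dV k) = dV k) (hdV0 : ∀ k, dV k ≠ 0)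
    (ιV : (sec42DataOf h isoOf ⟨HodgeCM.CMField.K F⟩ ι₁ V Φ).G →* UnitaryGroup.finAdelic ↥(maximalRealSubfield (F : Type)) (F : Type) (IsCMField.complexConj (F : Type)) 3 (Matrix.diagonal dV)) (hιV : Function.Surjective ιV)
    (r : Rep ↥(maximalRealSubfield (F : Type)) (imagUnitSq (F : Type)))
    (μ : Literature.NumberTheory.Automorphic.IdeleClassGroup (F : Type) →ₜ* Circle) (hμ : IdeleClassGroup.IsConjugateSymplectic (F : Type) μ)
    (hw : IdeleClassGroup.HasWeight (F : Type) μ 1)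
    (hD1R : ∀ (k : (toThm418Data _ (restOfCharDeltaPrime h ⟨HodgeCM.CMField.K F⟩ h6 ι₁ V Φ e₁ dV hdV hdV0 ιV r μ hμ hw)).AdmIndex) (v : HeightOneSpectrum (𝓞 ↥(maximalRealSubfield (F : Type)))),
      LemD1_1AsPrinted
        (Def411WeilCarriers.localLemD1Data ↥(maximalRealSubfield (F : Type)) (F : Type) (IsCMField.complexConj (F : Type)) 3 e₁ (Matrix.diagonal dV) (complexConj_imagUnit (F : Type)) (imagUnit_ne_zero (F : Type)) (imagUnit_mul_self (F : Type)) (realDiagonal_isSymm (F : Type) dV hdV) (isUnit_det_realDiagonal (F : Type) dV hdV hdV0) (realDiagonal_map (F : Type) dV hdV).symm (r.toFun k.1.1)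
          ((fun b => OmegaChiSplitting.chiLocalSplittingsD ⟨HodgeCM.CMField.K F⟩ e₁ dV hdV hdV0 (toHeckeCharacter (F : Type) μ) ((isOscillatorChar_toHeckeCharacter_iff μ).mpr hμ) b) (r.toFun k.1.1)) (le_refl 3) (localMu (F : Type) (toHeckeCharacter (F : Type) μ)) (fun v x => norm_localMu (F : Type) (toHeckeCharacter (F : Type) μ) v (isUnitary_toHeckeCharacter (F : Type) μ) x) (continuous_localMu (F : Type) (toHeckeCharacter (F : Type) μ)) (fun v t => localMu_toLocalRing_eq_one_iff (F : Type) (toHeckeCharacter (F : Type) μ) v ((isOscillatorChar_toHeckeCharacter_iff μ).mpr hμ) t) k.1.2.1 (Def411WeilCarriers.norm_chi_eq_one ↥(maximalRealSubfield (F : Type)) (F : Type) (IsCMField.complexConj (F : Type)) (Algebra.IsQuadraticExtension.finrank_eq_two ↥(maximalRealSubfield (F : Type)) (F : Type)) (UnitaryGroup.algEquiv_ne_one_of_apply_eq_neg ↥(maximalRealSubfield (F : Type)) (F : Type) (IsCMField.complexConj (F : Type)) (complexConj_imagUnit (F : Type)) (imagUnit_ne_zero (F : Type))) k.1.2) k.1.2.2.1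 v))
    (σ : ℂ ≃+* ℂ) (hσ : ∀ z : ℂ, z ∈ Liu2021.fieldOfValues (F : Type) μ → σ z = z)
    (i j : (toThm418Data _ (restOfCharDeltaPrime h ⟨HodgeCM.CMField.K F⟩ h6 ι₁ V Φ e₁ dV hdV hdV0 ιV r μ hμ hw)).AdmIndex)
    (hij : ∃ f : (toThm418Data _ (restOfCharDeltaPrime h ⟨HodgeCM.CMField.K F⟩ h6 ι₁ V Φ e₁ dV hdV hdV0 ιV r μ hμ hw)).omegaAt i →ₛₗ[(σ : ℂ →+* ℂ)] (toThm418Data _ (restOfCharDeltaPrime h ⟨HodgeCM.CMField.K F⟩ h6 ι₁ V Φ e₁ dV hdV hdV0 ιV r μ hμ hw)).omegaAt j,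
      Function.Bijective f ∧ ∀ (g : (toThm418Data _ (restOfCharDeltaPrime h ⟨HodgeCM.CMField.K F⟩ h6 ι₁ V Φ e₁ dV hdV hdV0 ιV r μ hμ hw)).G) (w : (toThm418Data _ (restOfCharDeltaPrime h ⟨HodgeCM.CMField.K F⟩ h6 ι₁ V Φ e₁ dV hdV hdV0 ιV r μ hμ hw)).omegaAt i),
        f ((toThm418Data _ (restOfCharDeltaPrime h ⟨HodgeCM.CMField.K F⟩ h6 ι₁ V Φ e₁ dV hdV hdV0 ιV r μ hμ hw)).rhoAt i g w) = (toThm418Data _ (restOfCharDeltaPrime h ⟨HodgeCM.CMField.K F⟩ h6 ι₁ V Φ e₁ dV hdV hdV0 ιV r μ hμ hw)).rhoAt j g (f w)) :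
    i.1.1 = j.1.1 := by
  classical
  haveI : RingHomSurjective (σ : ℂ →+* ℂ) := ⟨σ.surjective⟩
  -- `ω_i ≠ 0` ([Lem D.1 (1)] AS PRINTED)
  have hnt := nontrivial_omegaAt_restOfCharDeltaPrime_of_lemD1AsPrinted h ⟨HodgeCM.CMField.K F⟩ h6 ι₁ V Φ e₁ dV hdV hdV0 ιV r μ hμ hw hιV (le_refl 3) i (hD1R i)
  -- the places data shared by all members
  have hJh := Def411WeilCarriers.transpose_map_conj_JV ↥(maximalRealSubfield (F : Type)) (F : Type) (IsCMField.complexConj (F : Type)) 3 (Matrix.diagonal dV) (realDiagonal_isSymm (F : Type) dV hdV) (realDiagonal_map (F : Type) dV hdV).symm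
  have hJdet := Def411WeilCarriers.det_JV_ne_zero ↥(maximalRealSubfield (F : Type)) (F : Type) 3 (Matrix.diagonal dV) (isUnit_det_realDiagonal (F : Type) dV hdV hdV0) (realDiagonal_map (F : Type) dV hdV).symm
  have h23 : (2 : ℕ) ≤ 3 := by norm_num
  -- PER PLACE: the Step-1 representatives of `⟨a_i⟩`, `⟨a_j⟩` lie in one class
  have hloc : ∀ v : HeightOneSpectrum (𝓞 ↥(maximalRealSubfield (F : Type))),
      LemD1.SameClass (S := LemD1OfPlace.standingData (F : Type) v (IsCMField.complexConj (F : Type)) 3 (Matrix.diagonal dV) (complexConj_imagUnit (F : Type)) (imagUnit_ne_zero (F : Type)) h23 hJh hJdet)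
        ⟨epsLine (F : Type) (imagUnit_ne_zero (F : Type)) (r.toFun i.1.1) v, Def411WeilCarriers.epsLine_mem_skew (F : Type) (IsCMField.complexConj (F : Type)) 3 (Matrix.diagonal dV) (complexConj_imagUnit (F : Type)) (imagUnit_ne_zero (F : Type)) h23 hJh hJdet (r.toFun i.1.1) v⟩
        ⟨epsLine (F : Type) (imagUnit_ne_zero (F : Type)) (r.toFun j.1.1) v, Def411WeilCarriers.epsLine_mem_skew (F : Type) (IsCMField.complexConj (F : Type)) 3 (Matrix.diagonal dV) (complexConj_imagUnit (F : Type)) (imagUnit_ne_zero (F : Type)) h23 hJh hJdet (r.toFun j.1.1) v⟩ := by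
    intro v
    by_cases hsplit : IsField (UnitaryGroup.LocalRing (F : Type) v)
    · -- NON-SPLIT `v`
      -- the residue characteristic, the cyclotomic unit `κ` of `σ` at `v`, a global `t` in its square class, and `κ ∈ Nm`
      obtain ⟨p, hp, hpv⟩ := exists_prime_natCast_mem v
      haveI : Fact p.Prime := ⟨hp⟩
      obtain ⟨κ, hκ1, hκ⟩ := exists_ringEquiv_adeleAddCharAt_eq_mul ↥(maximalRealSubfield (F : Type)) v hpv σ
      obtain ⟨t, s, hst⟩ := hS ↥(maximalRealSubfield (F : Type)) v κ hκ1
      obtain ⟨y, hy⟩ : ∃ y : (UnitaryGroup.LocalRing (F : Type) v)ˣ,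
          (y : UnitaryGroup.LocalRing (F : Type) v) * UnitaryGroup.conjLocal (F : Type) (IsCMField.complexConj (F : Type)) v y =
            algebraMap (v.adicCompletion ↥(maximalRealSubfield (F : Type))) (UnitaryGroup.LocalRing (F : Type) v) κ := by
        by_cases h2 : (2 : 𝓞 ↥(maximalRealSubfield (F : Type))) ∈ v.asIdeal
        · exact hN₂ F μ hμ hw σ hσ v h2 hsplit κ hκ
        · exact hN F μ hμ hw σ hσ v h2 hsplit κ hκ
      -- the 3-member family `(a_i, χ_i), (t·a_i, σ∘χ_i), (a_j, χ_j)` at the label `μ`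
      let χσ : Chi ↥(maximalRealSubfield (F : Type)) (F : Type) (IsCMField.complexConj (F : Type)) :=
        ⟨(Units.map (σ : ℂ →* ℂ)).comp i.1.2.1, Def411WeilCarriers.isAutomorphicOneChar_unitsMap_ringEquiv_comp_chi (IsCMField.complexConj (F : Type)) i.1.2 σ⟩
      let aOf₃ : Fin 3 → (↥(maximalRealSubfield (F : Type)))ˣ := ![r.toFun i.1.1, t * r.toFun i.1.1, r.toFun j.1.1]
      let χOf₃ : Fin 3 → Chi ↥(maximalRealSubfield (F : Type)) (F : Type) (IsCMField.complexConj (F : Type)) := ![i.1.2, χσ, j.1.2]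
      -- (hT) the Galois twist of member `0` is member `1`
      have h01 : Literature.RepresentationTheory.Semisimple.AreSemilinearIso (σ : ℂ →+* ℂ)
          ((famAtV F e₁ dV hdV hdV0 (fun _ : Fin 3 => μ) (fun _ => hμ) aOf₃ χOf₃ v).quot 0)
          ((famAtV F e₁ dV hdV hdV0 (fun _ : Fin 3 => μ) (fun _ => hμ) aOf₃ χOf₃ v).quot 1) := by
        refine hT F dV hdV hdV0 (fun _ : Fin 3 => μ) (fun _ => hμ) aOf₃ χOf₃ v hsplit 0 1 rfl σ hσ κ hκ s ?_ ?_
        · show (s : v.adicCompletion ↥(maximalRealSubfield (F : Type))) * s * algebraMap ↥(maximalRealSubfield (F : Type)) (v.adicCompletion ↥(maximalRealSubfield (F : Type)))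
              (((t * r.toFun i.1.1 : (↥(maximalRealSubfield (F : Type)))ˣ) : ↥(maximalRealSubfield (F : Type))) * ((r.toFun i.1.1 : (↥(maximalRealSubfield (F : Type)))ˣ) : ↥(maximalRealSubfield (F : Type)))⁻¹) = κ
          rw [Units.val_mul, mul_inv_cancel_right₀ (Units.ne_zero _)]
          exact hst
        · intro u
          exact Def411WeilCarriers.coe_unitsMap_ringEquiv_comp_chi_apply (IsCMField.complexConj (F : Type)) i.1.2 σ u
      -- (P2) the Galois twist of member `0` is member `2`: σ-restriction of `hij` at `v`, read on `quot` along `quotEquivLocalType`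
      have h02 : Literature.RepresentationTheory.Semisimple.AreSemilinearIso (σ : ℂ →+* ℂ)
          ((famAtV F e₁ dV hdV hdV0 (fun _ : Fin 3 => μ) (fun _ => hμ) aOf₃ χOf₃ v).quot 0)
          ((famAtV F e₁ dV hdV hdV0 (fun _ : Fin 3 => μ) (fun _ => hμ) aOf₃ χOf₃ v).quot 2) := by
        obtain ⟨g, hg, hge⟩ := Def411WeilCarriers.exists_semilinear_localTypes_of_semilinear (τ := (σ : ℂ →+* ℂ)) ↥(maximalRealSubfield (F : Type)) (F : Type) (IsCMField.complexConj (F : Type)) 3 e₁ (Matrix.diagonal dV)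
          (complexConj_imagUnit (F : Type)) (imagUnit_ne_zero (F : Type)) (imagUnit_mul_self (F : Type)) (realDiagonal_isSymm (F : Type) dV hdV) (isUnit_det_realDiagonal (F : Type) dV hdV hdV0) (realDiagonal_map (F : Type) dV hdV).symm
          (fun b => OmegaChiSplitting.hsChiD ⟨HodgeCM.CMField.K F⟩ e₁ dV hdV hdV0 (toHeckeCharacter (F : Type) μ) (isUnitary_toHeckeCharacter (F : Type) μ) ((isOscillatorChar_toHeckeCharacter_iff μ).mpr hμ) b)
          (fun b => OmegaChiSplitting.hsChiD ⟨HodgeCM.CMField.K F⟩ e₁ dV hdV hdV0 (toHeckeCharacter (F : Type) μ) (isUnitary_toHeckeCharacter (F : Type) μ) ((isOscillatorChar_toHeckeCharacter_iff μ).mpr hμ) b)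
          (r.toFun i.1.1) i.1.2 ((fun b => OmegaChiSplitting.chiLocalSplittingsD ⟨HodgeCM.CMField.K F⟩ e₁ dV hdV hdV0 (toHeckeCharacter (F : Type) μ) ((isOscillatorChar_toHeckeCharacter_iff μ).mpr hμ) b) (r.toFun i.1.1)) (r.toFun j.1.1) j.1.2 ((fun b => OmegaChiSplitting.chiLocalSplittingsD ⟨HodgeCM.CMField.K F⟩ e₁ dV hdV hdV0 (toHeckeCharacter (F : Type) μ) ((isOscillatorChar_toHeckeCharacter_iff μ).mpr hμ) b) (r.toFun j.1.1))
          (OmegaChiSplitting.hfac_sChiD ⟨HodgeCM.CMField.K F⟩ e₁ dV hdV hdV0 (toHeckeCharacter (F : Type) μ) (isUnitary_toHeckeCharacter (F : Type) μ) ((isOscillatorChar_toHeckeCharacter_iff μ).mpr hμ) (r.toFun i.1.1))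
          (OmegaChiSplitting.hfac_sChiD ⟨HodgeCM.CMField.K F⟩ e₁ dV hdV hdV0 (toHeckeCharacter (F : Type) μ) (isUnitary_toHeckeCharacter (F : Type) μ) ((isOscillatorChar_toHeckeCharacter_iff μ).mpr hμ) (r.toFun j.1.1))
          (le_refl 3) (localMu (F : Type) (toHeckeCharacter (F : Type) μ)) (fun v x => norm_localMu (F : Type) (toHeckeCharacter (F : Type) μ) v (isUnitary_toHeckeCharacter (F : Type) μ) x) (continuous_localMu (F : Type) (toHeckeCharacter (F : Type) μ)) (fun v t => localMu_toLocalRing_eq_one_iff (F : Type) (toHeckeCharacter (F : Type) μ) v ((isOscillatorChar_toHeckeCharacter_iff μ).mpr hμ) t) (localMu (F : Type) (toHeckeCharacter (F : Type) μ)) (fun v x => norm_localMu (F : Type) (toHeckeCharacter (F : Type) μ) v (isUnitary_toHeckeCharacter (F : Type) μ) x) (continuous_localMu (F : Type) (toHeckeCharacter (F : Type) μ)) (fun v t => localMu_toLocalRing_eq_one_iff (F : Type) (toHeckeCharacter (F : Type) μ) v ((isOscillatorChar_toHeckeCharacter_iff μ).mpr hμ) t) (hD1R i) (hD1R j) hιV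 hnt hij v
        have Ei := Def411WeilCarriers.quotEquivLocalType ↥(maximalRealSubfield (F : Type)) (F : Type) (IsCMField.complexConj (F : Type)) 3 e₁ (Matrix.diagonal dV) (complexConj_imagUnit (F : Type)) (imagUnit_ne_zero (F : Type)) (imagUnit_mul_self (F : Type)) (realDiagonal_isSymm (F : Type) dV hdV) (isUnit_det_realDiagonal (F : Type) dV hdV hdV0) (realDiagonal_map (F : Type) dV hdV).symm (r.toFun i.1.1)
          ((fun b => OmegaChiSplitting.chiLocalSplittingsD ⟨HodgeCM.CMField.K F⟩ e₁ dV hdV hdV0 (toHeckeCharacter (F : Type) μ) ((isOscillatorChar_toHeckeCharacter_iff μ).mpr hμ) b) (r.toFun i.1.1)) (le_refl 3) (localMu (F : Type) (toHeckeCharacter (F : Type) μ)) (fun v x => norm_localMu (F : Type) (toHeckeCharacter (F : Type) μ) v (isUnitary_toHeckeCharacter (F : Type) μ) x) (continuous_localMu (F : Type) (toHeckeCharacter (F : Type) μ)) (fun v t => localMu_toLocalRing_eq_one_iff (F : Type) (toHeckeCharacter (F : Type) μ) v ((isOscillatorChar_toHeckeCharacter_iff μ).mpr hμ) t) i.1.2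 v
        have Ej := Def411WeilCarriers.quotEquivLocalType ↥(maximalRealSubfield (F : Type)) (F : Type) (IsCMField.complexConj (F : Type)) 3 e₁ (Matrix.diagonal dV) (complexConj_imagUnit (F : Type)) (imagUnit_ne_zero (F : Type)) (imagUnit_mul_self (F : Type)) (realDiagonal_isSymm (F : Type) dV hdV) (isUnit_det_realDiagonal (F : Type) dV hdV hdV0) (realDiagonal_map (F : Type) dV hdV).symm (r.toFun j.1.1)
          ((fun b => OmegaChiSplitting.chiLocalSplittingsD ⟨HodgeCM.CMField.K F⟩ e₁ dV hdV hdV0 (toHeckeCharacter (F : Type) μ) ((isOscillatorChar_toHeckeCharacter_iff μ).mpr hμ) b) (r.toFun j.1.1)) (le_refl 3) (localMu (F : Type) (toHeckeCharacter (F : Type) μ)) (fun v x => norm_localMu (F : Type) (toHeckeCharacter (F : Type) μ) v (isUnitary_toHeckeCharacter (F : Type) μ) x) (continuous_localMu (F : Type) (toHeckeCharacter (F : Type) μ)) (fun v t => localMu_toLocalRing_eq_one_iff (F : Type) (toHeckeCharacter (F : Type) μ) v ((isOscillatorChar_toHeckeCharacter_iff μ).mpr hμ) t) j.1.2 v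
        exact areSemilinearIso_of_equivs Ei Ej ⟨g, hg, fun u x => hge _ x⟩
      -- two-out-of-three: members `1` and `2` are LINEARLY isomorphic
      obtain ⟨e12, he12⟩ := Literature.RepresentationTheory.Semisimple.AreSemilinearIso.exists_linearEquiv_of_two σ.surjective h01 h02
      -- [Lem D.1 (3)]'s ε-clause at the non-split `v` (row IV-4c1 ✔): `t a_i ≡ a_j`
      have h21 := (Def411WeilCarriers.sameClass_and_chi_eq_of_areIsomorphicRep_nonsplit_prodUnique ↥(maximalRealSubfield (F : Type)) (F : Type) (IsCMField.complexConj (F : Type)) (Matrix.diagonal dV) (complexConj_imagUnit (F : Type)) (imagUnit_ne_zero (F : Type)) (imagUnit_mul_self (F : Type))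
        rankOne_theta_lines_disjoint_holds (realDiagonal_isSymm (F : Type) dV hdV) (isUnit_det_realDiagonal (F : Type) dV hdV hdV0) (realDiagonal_map (F : Type) dV hdV).symm aOf₃ χOf₃
        (fun k => OmegaChiSplitting.chiLocalSplittingsD ⟨HodgeCM.CMField.K F⟩ e₁ dV hdV hdV0 (toHeckeCharacter (F : Type) μ) ((isOscillatorChar_toHeckeCharacter_iff μ).mpr hμ) (aOf₃ k))
        (fun _ => (localMu (F : Type) (toHeckeCharacter (F : Type) μ))) (fun _ v x => norm_localMu (F : Type) (toHeckeCharacter (F : Type) μ) v (isUnitary_toHeckeCharacter (F : Type) μ) x) (fun _ => (continuous_localMu (F : Type) (toHeckeCharacter (F : Type) μ)))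
        (fun _ v t => localMu_toLocalRing_eq_one_iff (F : Type) (toHeckeCharacter (F : Type) μ) v ((isOscillatorChar_toHeckeCharacter_iff μ).mpr hμ) t) v hsplit 2 1 ⟨e12, he12⟩).1
      obtain ⟨x, hx⟩ := h21
      change epsLine (F : Type) (imagUnit_ne_zero (F : Type)) (t * r.toFun i.1.1) v =
        x * Units.map (UnitaryGroup.conjLocal (F : Type) (IsCMField.complexConj (F : Type)) v : UnitaryGroup.LocalRing (F : Type) v →* UnitaryGroup.LocalRing (F : Type) v) x *
          epsLine (F : Type) (imagUnit_ne_zero (F : Type)) (r.toFun j.1.1) v at hx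
      -- the Step-1 representative of `⟨t a_i⟩` is `ι_v(t) · ε_i`; `ι_v(κ) = y ȳ`, `κ = s² t`
      have hE1 := Def411WeilCarriers.epsLine_eq_mul ↥(maximalRealSubfield (F : Type)) (F : Type) (imagUnit_ne_zero (F : Type)) (r.toFun i.1.1) (t * r.toFun i.1.1) v
      rw [mul_inv_cancel_right] at hE1
      have hy' : y * Units.map (UnitaryGroup.conjLocal (F : Type) (IsCMField.complexConj (F : Type)) v : UnitaryGroup.LocalRing (F : Type) v →* UnitaryGroup.LocalRing (F : Type) v) y =
          Units.map (UnitaryGroup.toLocalRing (F : Type) v).toMonoidHom s * Units.map (UnitaryGroup.toLocalRing (F : Type) v).toMonoidHom s *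
            Units.map (UnitaryGroup.toLocalRing (F : Type) v).toMonoidHom (Units.map (algebraMap ↥(maximalRealSubfield (F : Type)) (v.adicCompletion ↥(maximalRealSubfield (F : Type)))).toMonoidHom t) := by
        apply Units.ext
        simp only [Units.val_mul, Units.coe_map, MonoidHom.coe_coe, RingHom.toMonoidHom_eq_coe]
        rw [hy, UnitaryGroup.algebraMap_localRing_eq, ← map_mul, ← map_mul, hst]
      refine ⟨x⁻¹ * (Units.map (UnitaryGroup.toLocalRing (F : Type) v).toMonoidHom s)⁻¹ * y, ?_⟩
      exact units_sameClass_chain (Units.map (UnitaryGroup.conjLocal (F : Type) (IsCMField.complexConj (F : Type)) v : UnitaryGroup.LocalRing (F : Type) v →* UnitaryGroup.LocalRing (F : Type) v))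
        hE1 hx hy' (Units.ext (by
          rw [Units.coe_map, Units.coe_map, MonoidHom.coe_coe, RingHom.toMonoidHom_eq_coe, MonoidHom.coe_coe, UnitaryGroup.conjLocal_toLocalRing]))
    · -- SPLIT `v`: one class
      obtain ⟨w, hw'⟩ := Literature.NumberTheory.Automorphic.Liu2021.SplitPlace.exists_placesOver_smul_ne_of_not_isField (F : Type) v (IsCMField.complexConj (F : Type))
        (UnitaryGroup.algEquiv_ne_one_of_apply_eq_neg ↥(maximalRealSubfield (F : Type)) (F : Type) (IsCMField.complexConj (F : Type)) (complexConj_imagUnit (F : Type)) (imagUnit_ne_zero (F : Type))) hsplit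
      exact Literature.NumberTheory.Automorphic.Liu2021.LemD1IndexedNonVacuityNonsplitPlace.sameClass_of_split (F : Type) v (IsCMField.complexConj (F : Type)) (complexConj_imagUnit (F : Type)) (imagUnit_ne_zero (F : Type)) 3 (Matrix.diagonal dV)
        h23 hJh hJdet w hw' _ _
  -- GLOBALISE: equal collections, then the faithful section recovers `ε`
  have key : locF ↥(maximalRealSubfield (F : Type)) (imagUnitSq (F : Type)) (r.toFun i.1.1) = locF ↥(maximalRealSubfield (F : Type)) (imagUnitSq (F : Type)) (r.toFun j.1.1) :=
    Def411WeilCarriers.locF_eq_of_forall_sameClass_epsLine ↥(maximalRealSubfield (F : Type)) (F : Type) (IsCMField.complexConj (F : Type)) 3 (Matrix.diagonal dV) (complexConj_imagUnit (F : Type)) (imagUnit_ne_zero (F : Type)) (imagUnit_mul_self (F : Type)) h23 hJh hJdet (r.toFun i.1.1) (r.toFun j.1.1) hloc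
  have hglob : ∀ k : (toThm418Data _ (restOfCharDeltaPrime h ⟨HodgeCM.CMField.K F⟩ h6 ι₁ V Φ e₁ dV hdV hdV0 ιV r μ hμ hw)).AdmIndex, ∃ b, locF ↥(maximalRealSubfield (F : Type)) (imagUnitSq (F : Type)) b = k.1.1 := fun k => by
    obtain ⟨x, -, hx⟩ := k.2
    obtain ⟨b, hb⟩ := Def411WeilCarriers.exists_locF_eq_epsOf ↥(maximalRealSubfield (F : Type)) (F : Type) (imagUnitSq (F : Type)) (2 * imagUnit (F : Type))⁻¹ x
    exact ⟨b, hb.trans hx⟩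
  exact ((r.locF_toFun i.1.1 (hglob i)).symm.trans key).trans (r.locF_toFun j.1.1 (hglob j))

end OwnRest

/-! ## §3 THE CLOSING THEOREM of the III-11 road: `EpsRigidAtFace` from the three local facts -/

section Face

set_option maxHeartbeats 800000 in -- ed.2 (A-p19 g9): was 8 000 000; 1.82 M measured before the `restOfCharRep_eq_rest` rewrite, < 0.8 M after
set_option synthInstance.maxHeartbeats 400000 in
/-- **Row III-11 CLOSED MODULO THE ROAD'S LOCAL FACTS — `EpsRigidAtFace` (the type of the registered residual `stub_epsRigidAtFace` of
`Cruxes/HLiu418/Lines/a3_liu418.lean`, = [Liu2021, Thm. 4.18 (3)]'s ε-rigidity under `Gal(ℂ/M_ν)` at the face datum `D₀ = toThm418Data ℭ_V ((muConj 𝕌_V).rest t_ν)`)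
from `LocalTypeGaloisTwist` (local Galois twist of a member is a member; fan B), `CyclotomicUnitIsLocalNormOdd` ∕ `CyclotomicUnitIsLocalNormDyadic`
(the cyclotomic unit of `σ ∈ Aut(ℂ/M_ν)` is a local norm; (NT) core) and `PrescribedLocalSquareClass` (elementary).**  `D₀`'s summands are `V`'s own
[Def 4.11] carriers at the label `νᶜ` (`muConj`, ✔ `admIndexMuConjEquiv`, summands equal on the nose) and `M_{νᶜ} = M_ν` (✔ `fieldOfValues_galConj_complexConj`),
so §2 at `μ := νᶜ` (frame `(e₁, frameD V, ιVE V)` — `ιVE V` onto by ✔ `finPart_cmKTypeHom_finAdelicToAdelic_surjective` —, section `r_a`, [Lem D.1 (1)] by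
✔ `HD1pp_proof`, weight one by ✔ `HasWeight.galConj_complexConj`) and §1.  The crux's slot: `stub_epsRigidAtFace := epsRigidAtFace_of_localTwist ‹LocalTypeGaloisTwist›
‹CyclotomicUnitIsLocalNormOdd› ‹CyclotomicUnitIsLocalNormDyadic› ‹PrescribedLocalSquareClass›`.  Orientation-free; hD3 ∕ c3 NOT used (only row IV-4c1).
HC_CM is proved only modulo the 7 printed citations until rung 0 closes.
[cite: Liu2021, Thm. 4.18 (3) (l. 2243) with proof l. 2272–2289; Rem. 4.4; Def. 4.11–4.12; App. D Lem. D.1 (1), (3)] [cite: FlathCorvallis1979, Theorem 3 (uniqueness clause)] -/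
theorem epsRigidAtFace_of_localTwist (hT : LocalTypeGaloisTwist) (hN : CyclotomicUnitIsLocalNormOdd)
    (hN₂ : CyclotomicUnitIsLocalNormDyadic) (hS : PrescribedLocalSquareClass) : EpsRigidAtFace := by
  intro hDel F _ h6 ι₁ V a Φ hΦ ν hν hw
  have hw' : IdeleClassGroup.HasWeight (F : Type) (galConj (IsCMField.complexConj (F : Type)) ν) 1 := hw.galConj_complexConj
  refine epsRigid_muConj_rest (C := CV hDel F V Φ) (uniformOmegaRep (Summit.HodgeConjecture.CorCM.DelRec.exists_recordSystem_of_printed hDel) ⟨HodgeCM.CMField.K F⟩ ι₁ (⟨HodgeCM.HermSpace3.Hm V, HodgeCM.HermSpace3.isHermitian V, HodgeCM.HermSpace3.signature_ι₁ V, HodgeCM.HermSpace3.posDef_of_ne V⟩ : Summit.HodgeConjecture.CorCM.HermSpace3 ⟨HodgeCM.CMField.K F⟩ ι₁) Φ e₁ (frameD V) (frameD_real V) (frameD_ne V) (ιVE V) (2 * imagUnit (HodgeCM.CMField.K F))⁻¹ (fun _ _ => (Rep.update ↥(maximalRealSubfield (HodgeCM.CMField.K F)) (imagUnitSq (HodgeCM.CMField.K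 F)) (Rep.ofLineOf ↥(maximalRealSubfield (HodgeCM.CMField.K F)) (imagUnitSq (HodgeCM.CMField.K F))) (locF ↥(maximalRealSubfield (HodgeCM.CMField.K F)) (imagUnitSq (HodgeCM.CMField.K F)) (realUnit ⟨HodgeCM.CMField.K F⟩ a.1 a.2.1 a.2.2)) (realUnit ⟨HodgeCM.CMField.K F⟩ a.1 a.2.1 a.2.2) rfl)))
    (restTailOne (AlgHom.id ℚ _) ι₁ hν.galConj hw' (Def45.Carriers.ofPolDR (galConj (IsCMField.complexConj (F : Type)) ν) (Def45.PolDR ι₁ hν.galConj (Def45.RMuForm ι₁ hν.galConj))) ((heckeTranslatesFamilyOf heckeTranslate_definedOver_holds (Summit.HodgeConjecture.CorCM.DelRec.exists_recordSystem_of_printed hDel) isoOf ⟨HodgeCM.CMField.K F⟩ ι₁ (⟨HodgeCM.HermSpace3.Hm V, HodgeCM.HermSpace3.isHermitian V, HodgeCM.HermSpace3.signature_ι₁ V, HodgeCM.HermSpace3.posDef_of_ne V⟩ : Summit.HodgeConjecture.CorCM.HermSpace3 ⟨HodgeCM.CMField.K F⟩ ι₁) Φ h6).rhoΩOne (AlgHom.id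 ℚ _) ι₁ hν.galConj hw' (Def45.Carriers.ofPolDR (galConj (IsCMField.complexConj (F : Type)) ν) (Def45.PolDR ι₁ hν.galConj (Def45.RMuForm ι₁ hν.galConj)))))
    (restTailOne (AlgHom.id ℚ _) ι₁ hν hw (CarN F ι₁ ν hν) ((TV hDel F h6 V Φ).rhoΩOne (AlgHom.id ℚ _) ι₁ hν hw (CarN F ι₁ ν hν))) rfl ?_
  -- ed.2 (A-p19 g9, A-p18 census ED-ER-HB): `𝕌_V.rest t_{νᶜ}` IS `V`'s generic rest `restOfCharRep … δ′ r νᶜ` (✔ `restOfCharRep_eq_rest`, `rfl`) — used as a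
  -- REWRITE so that §2's `restOfCharDeltaPrime`-spelled statement meets the goal near-syntactically (no carrier unfolded by `isDefEq`)
  have key := restOfCharRep_eq_rest (Summit.HodgeConjecture.CorCM.DelRec.exists_recordSystem_of_printed hDel) ⟨HodgeCM.CMField.K F⟩ ι₁ (⟨HodgeCM.HermSpace3.Hm V, HodgeCM.HermSpace3.isHermitian V, HodgeCM.HermSpace3.signature_ι₁ V, HodgeCM.HermSpace3.posDef_of_ne V⟩ : Summit.HodgeConjecture.CorCM.HermSpace3 ⟨HodgeCM.CMField.K F⟩ ι₁) Φ e₁ (frameD V)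
    (frameD_real V) (frameD_ne V) (ιVE V) (2 * imagUnit (HodgeCM.CMField.K F))⁻¹ (fun _ _ => (Rep.update ↥(maximalRealSubfield (HodgeCM.CMField.K F)) (imagUnitSq (HodgeCM.CMField.K F)) (Rep.ofLineOf ↥(maximalRealSubfield (HodgeCM.CMField.K F)) (imagUnitSq (HodgeCM.CMField.K F))) (locF ↥(maximalRealSubfield (HodgeCM.CMField.K F)) (imagUnitSq (HodgeCM.CMField.K F)) (realUnit ⟨HodgeCM.CMField.K F⟩ a.1 a.2.1 a.2.2)) (realUnit ⟨HodgeCM.CMField.K F⟩ a.1 a.2.1 a.2.2) rfl)) h6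
    (galConj (IsCMField.complexConj (F : Type)) ν) hν.galConj hw'
  rw [← key]
  intro σ hσ i j hij
  have hσ' : ∀ z : ℂ, z ∈ Liu2021.fieldOfValues (F : Type) (galConj (IsCMField.complexConj (F : Type)) ν) → σ z = z := by
    rw [Summit.HodgeConjecture.CorCM.D2Bridge.fieldOfValues_galConj_complexConj]
    exact hσ
  exact epsRigid_ownRest_of_localTwist hT hN hN₂ hS (Summit.HodgeConjecture.CorCM.DelRec.exists_recordSystem_of_printed hDel) F h6 ι₁ (⟨HodgeCM.HermSpace3.Hm V, HodgeCM.HermSpace3.isHermitian V, HodgeCM.HermSpace3.signature_ι₁ V, HodgeCM.HermSpace3.posDef_of_ne V⟩ : Summit.HodgeConjecture.CorCM.HermSpace3 ⟨HodgeCM.CMField.K F⟩ ι₁) Φ (frameD V) (frameD_real V) (frameD_ne V) (ιVE V)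
    (UnitaryDualPair.finPart_cmKTypeHom_finAdelicToAdelic_surjective (F : Type) V.Hm (frameG V) (frameD V) (frame_congr V)) (Rep.update ↥(maximalRealSubfield (HodgeCM.CMField.K F)) (imagUnitSq (HodgeCM.CMField.K F)) (Rep.ofLineOf ↥(maximalRealSubfield (HodgeCM.CMField.K F)) (imagUnitSq (HodgeCM.CMField.K F))) (locF ↥(maximalRealSubfield (HodgeCM.CMField.K F)) (imagUnitSq (HodgeCM.CMField.K F)) (realUnit ⟨HodgeCM.CMField.K F⟩ a.1 a.2.1 a.2.2)) (realUnit ⟨HodgeCM.CMField.K F⟩ a.1 a.2.1 a.2.2) rfl)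
    (galConj (IsCMField.complexConj (F : Type)) ν) hν.galConj hw'
    (fun k v => (Summit.HodgeConjecture.HodgeConjecture.Theorems.HD1pp_proof :
      Summit.HodgeConjecture.CorCM.D2Bridge.MuKeyIdentLemD3DelRecConjOmegaEndT.PrintedCitationHypotheses.HypD1pp) hDel F h6 V a Φ hΦ _ hν.galConj hw' k v)
    σ hσ' i j hij

end Face

end Summit.HodgeConjecture.CorCM.Lines.A3Liu418

end
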